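import Summits.HodgeConjecture.HodgeConjecture.Theorems.R90S3TransportDeltaTransfer   -- ★ p862979 (this seat): `coe_endoEmb_transport`, `isConj_map_ringEquiv_iff`
import HarnessLib

/-!
# R90-TF · S3 wave 4 (J-S3-3), toward BRICK G1: THE MATCHING CONDITION `ι_v(γ_H) ↔ γ` TRANSPORTS along a ground-field change
# (`Theorems/R90S3TransportNormPair.lean` — the support half of socket `stub_R90_S3_transport_delta`; census-first item booked for K2E4-p14 (g12))

Cell `hodgecm-mathlib`, crux H413 (`stmt-HodgeConjecture-24833`), route of record `HCCMUnconditional`; programme R90-TF, section S3 (base `R90-C12`), wave 4 «LOCAL TRANSPORT»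
(S3-R12; dealer R90-C12-plan (g2) 23:19:08Z: «G1 → K2E4-p14 g12, census-first»).  Seat K2E4-p14 (g11).  Lane `--supports stmt-HodgeConjecture-24833 --as helper`;
THEOREMS ONLY; ★-only imports; ns `…R90.S3`.

THE MATHEMATICS [Rogawski1990 §4.9 p. 54; §14.1 p. 232; §4.3 p. 43].  ★ `finExplicitDelta L v H′ γ_H μ γ′` («Δ‴_v») is `τ_v · D_{G∕H,v} · κ_v` ON THE MATCHING PAIRS
`ι_v(γ_H) ↔ γ′` (★ `IsLocalNormPair` = ★ `Corresponds` of `ι_v(γ_H)` and `γ′` = CONJUGACY IN THE AMBIENT `GL₃(R_v)`) and `0` off them.  Along the S3 currency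
`Φ : R_v ≃+* R′_{v′}` with `e_H = (e₂, e₁)`, `e₃` acting entrywise by `Φ` (`heₙ`), `ι(e_H γ_H) = Φ·ι(γ_H)` entrywise (★ p862979 `coe_endoEmb_transport`) and `GL`-conjugacy is
`Φ`-invariant (★ p862979 `isConj_map_ringEquiv_iff`), so **the matching condition transports**: `ι_{v′}(e_H γ_H) ↔ e₃ γ′ iff ι_v(γ_H) ↔ γ′` — G1's SUPPORT half
(`Δ‴ = 0` branch) is thereby settled; its value half (`τ_v` via `hΦμ`, `κ_v` via the unit-norm test of ★ p863112, `D_{G∕H,v}` via the place-wise isometry of `Φ`) is g12's.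
* HEAD **`isLocalNormPair_transport_iff`**; corollary `finExplicitDelta_transport_of_not_isLocalNormPair` (both factors vanish off the matching pairs).
HONEST LABEL: transport-of-structure bookkeeping, no print input; HC_CM is proved only modulo the 7 printed citations (2 remaining named inputs: hLiu418 = stmt-HodgeConjecture-24832,
h413 = stmt-HodgeConjecture-24833) until rung 0 closes; count-neutral helper (G1 itself stays open).

## References
* [Rogawski1990] J. D. Rogawski, *Automorphic Representations of Unitary Groups in Three Variables*, Ann. of Math. Stud. 123 (1990), §4.9 pp. 54–55; §14.1 p. 232; §4.3 p. 43.
-/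

set_option autoImplicit false
-- the mandated namespace repeats the single-problem summit's segment (`HodgeConjecture.HodgeConjecture`)
set_option linter.dupNamespace false

noncomputable section

open IsDedekindDomain NumberField
open Literature.NumberTheory Literature.NumberTheory.Automorphic Literature.NumberTheory.Automorphic.UnitaryGroup
open Literature.NumberTheory.Rogawski1990 Literature.NumberTheory.GaloisRepresentations
open scoped Matrix MatrixGroups

namespace Summit.HodgeConjecture.HodgeConjecture.R90.S3

variable (L : Type) [Field L] [NumberField L] [IsCMField L] (H' : Matrix (Fin 3) (Fin 3) L)
  (v : HeightOneSpectrum (𝓞 ↥(maximalRealSubfield L)))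

/-- **THE MATCHING CONDITION `ι_v(γ_H) ↔ γ′` TRANSPORTS ALONG THE GROUND-FIELD CHANGE** (`IsLocalNormPair` = `GL₃`-conjugacy of `ι_v(γ_H)` and `γ′`; `ι` commutes with
`(e_H, e₃)` on matrices, conjugacy is `Φ`-invariant). [cite: Rogawski1990, §4.9 p. 54; §14.1 p. 232] -/
theorem isLocalNormPair_transport_iff
    (L' : Type) [Field L'] [NumberField L'] [IsCMField L'] (v' : HeightOneSpectrum (𝓞 ↥(maximalRealSubfield L')))
    (Φ : UnitaryGroup.LocalRing L v ≃+* UnitaryGroup.LocalRing L' v') (H'' : Matrix (Fin 3) (Fin 3) L')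
    (e₃ : (UnitaryGroup.cmDatum L 3 H').Local v ≃ₜ* (UnitaryGroup.cmDatum L' 3 H'').Local v')
    (he₃ : ∀ g, ((e₃ g).val : GL (Fin 3) (UnitaryGroup.LocalRing L' v')) = Matrix.GeneralLinearGroup.map (Φ : UnitaryGroup.LocalRing L v →+* UnitaryGroup.LocalRing L' v') (g.val : GL (Fin 3) (UnitaryGroup.LocalRing L v)))
    (e₂ : (UnitaryGroup.cmDatum L 2 (Matrix.of fun i j : Fin 2 => if i.val + j.val + 1 = 2 then (1 : L) else 0)).Local v ≃ₜ*
      (UnitaryGroup.cmDatum L' 2 (Matrix.of fun i j : Fin 2 => if i.val + j.val + 1 = 2 then (1 : L') else 0)).Local v')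
    (he₂ : ∀ g, ((e₂ g).val : GL (Fin 2) (UnitaryGroup.LocalRing L' v')) = Matrix.GeneralLinearGroup.map (Φ : UnitaryGroup.LocalRing L v →+* UnitaryGroup.LocalRing L' v') (g.val : GL (Fin 2) (UnitaryGroup.LocalRing L v)))
    (e₁ : (UnitaryGroup.cmDatum L 1 (Matrix.of fun i j : Fin 1 => if i.val + j.val + 1 = 1 then (1 : L) else 0)).Local v ≃ₜ*
      (UnitaryGroup.cmDatum L' 1 (Matrix.of fun i j : Fin 1 => if i.val + j.val + 1 = 1 then (1 : L') else 0)).Local v')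
    (he₁ : ∀ g, ((e₁ g).val : GL (Fin 1) (UnitaryGroup.LocalRing L' v')) = Matrix.GeneralLinearGroup.map (Φ : UnitaryGroup.LocalRing L v →+* UnitaryGroup.LocalRing L' v') (g.val : GL (Fin 1) (UnitaryGroup.LocalRing L v)))
    (eH : ((UnitaryGroup.cmDatum L 2 (Matrix.of fun i j : Fin 2 => if i.val + j.val + 1 = 2 then (1 : L) else 0)).Local v ×
      (UnitaryGroup.cmDatum L 1 (Matrix.of fun i j : Fin 1 => if i.val + j.val + 1 = 1 then (1 : L) else 0)).Local v) ≃ₜ*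
      ((UnitaryGroup.cmDatum L' 2 (Matrix.of fun i j : Fin 2 => if i.val + j.val + 1 = 2 then (1 : L') else 0)).Local v' ×
      (UnitaryGroup.cmDatum L' 1 (Matrix.of fun i j : Fin 1 => if i.val + j.val + 1 = 1 then (1 : L') else 0)).Local v'))
    (heH : ∀ h, eH h = (e₂ h.1, e₁ h.2))
    (γH : ((UnitaryGroup.cmDatum L 2 (Matrix.of fun i j : Fin 2 => if i.val + j.val + 1 = 2 then (1 : L) else 0)).Local v ×
      (UnitaryGroup.cmDatum L 1 (Matrix.of fun i j : Fin 1 => if i.val + j.val + 1 = 1 then (1 : L) else 0)).Local v))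
    (γ : (UnitaryGroup.cmDatum L 3 H').Local v) :
    IsLocalNormPair L' H'' v' (eH γH) (e₃ γ) ↔ IsLocalNormPair L H' v γH γ := by
  unfold IsLocalNormPair EndoMatches Corresponds
  rw [coe_endoEmb_transport L v L' v' Φ e₂ he₂ e₁ he₁ eH heH γH]
  change IsConj _ ((e₃ γ).val : GL (Fin 3) (UnitaryGroup.LocalRing L' v')) ↔ _
  rw [he₃ γ]
  exact isConj_map_ringEquiv_iff Φ _ _

/-- **Corollary: off the matching pairs both explicit factors vanish together** — `¬ (ι_v(γ_H) ↔ γ′)` gives `Δ‴_v(γ_H, γ′) = 0` AND `Δ‴_{v′}(e_H γ_H, e₃ γ′) = 0`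
(★ `finExplicitDelta_of_not_isLocalNormPair` on both sides) — the support half of socket G1. [cite: Rogawski1990, §4.3 p. 43; §4.9 p. 55] -/
theorem finExplicitDelta_transport_of_not_isLocalNormPair
    (L' : Type) [Field L'] [NumberField L'] [IsCMField L'] (v' : HeightOneSpectrum (𝓞 ↥(maximalRealSubfield L')))
    (Φ : UnitaryGroup.LocalRing L v ≃+* UnitaryGroup.LocalRing L' v') (H'' : Matrix (Fin 3) (Fin 3) L')
    (μ : HeckeCharacter L) (μ' : HeckeCharacter L')
    (e₃ : (UnitaryGroup.cmDatum L 3 H').Local v ≃ₜ* (UnitaryGroup.cmDatum L' 3 H'').Local v')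
    (he₃ : ∀ g, ((e₃ g).val : GL (Fin 3) (UnitaryGroup.LocalRing L' v')) = Matrix.GeneralLinearGroup.map (Φ : UnitaryGroup.LocalRing L v →+* UnitaryGroup.LocalRing L' v') (g.val : GL (Fin 3) (UnitaryGroup.LocalRing L v)))
    (e₂ : (UnitaryGroup.cmDatum L 2 (Matrix.of fun i j : Fin 2 => if i.val + j.val + 1 = 2 then (1 : L) else 0)).Local v ≃ₜ*
      (UnitaryGroup.cmDatum L' 2 (Matrix.of fun i j : Fin 2 => if i.val + j.val + 1 = 2 then (1 : L') else 0)).Local v')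
    (he₂ : ∀ g, ((e₂ g).val : GL (Fin 2) (UnitaryGroup.LocalRing L' v')) = Matrix.GeneralLinearGroup.map (Φ : UnitaryGroup.LocalRing L v →+* UnitaryGroup.LocalRing L' v') (g.val : GL (Fin 2) (UnitaryGroup.LocalRing L v)))
    (e₁ : (UnitaryGroup.cmDatum L 1 (Matrix.of fun i j : Fin 1 => if i.val + j.val + 1 = 1 then (1 : L) else 0)).Local v ≃ₜ*
      (UnitaryGroup.cmDatum L' 1 (Matrix.of fun i j : Fin 1 => if i.val + j.val + 1 = 1 then (1 : L') else 0)).Local v')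
    (he₁ : ∀ g, ((e₁ g).val : GL (Fin 1) (UnitaryGroup.LocalRing L' v')) = Matrix.GeneralLinearGroup.map (Φ : UnitaryGroup.LocalRing L v →+* UnitaryGroup.LocalRing L' v') (g.val : GL (Fin 1) (UnitaryGroup.LocalRing L v)))
    (eH : ((UnitaryGroup.cmDatum L 2 (Matrix.of fun i j : Fin 2 => if i.val + j.val + 1 = 2 then (1 : L) else 0)).Local v ×
      (UnitaryGroup.cmDatum L 1 (Matrix.of fun i j : Fin 1 => if i.val + j.val + 1 = 1 then (1 : L) else 0)).Local v) ≃ₜ*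
      ((UnitaryGroup.cmDatum L' 2 (Matrix.of fun i j : Fin 2 => if i.val + j.val + 1 = 2 then (1 : L') else 0)).Local v' ×
      (UnitaryGroup.cmDatum L' 1 (Matrix.of fun i j : Fin 1 => if i.val + j.val + 1 = 1 then (1 : L') else 0)).Local v'))
    (heH : ∀ h, eH h = (e₂ h.1, e₁ h.2))
    {γH : ((UnitaryGroup.cmDatum L 2 (Matrix.of fun i j : Fin 2 => if i.val + j.val + 1 = 2 then (1 : L) else 0)).Local v ×
      (UnitaryGroup.cmDatum L 1 (Matrix.of fun i j : Fin 1 => if i.val + j.val + 1 = 1 then (1 : L) else 0)).Local v)}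
    {γ : (UnitaryGroup.cmDatum L 3 H').Local v} (h : ¬ IsLocalNormPair L H' v γH γ) :
    finExplicitDelta L' v' H'' (eH γH) μ' (e₃ γ) = finExplicitDelta L v H' γH μ γ := by
  rw [finExplicitDelta_of_not_isLocalNormPair L v H' γH μ h,
    finExplicitDelta_of_not_isLocalNormPair L' v' H'' (eH γH) μ'
      (fun h' => h ((isLocalNormPair_transport_iff L H' v L' v' Φ H'' e₃ he₃ e₂ he₂ e₁ he₁ eH heH γH γ).1 h'))]

end Summit.HodgeConjecture.HodgeConjecture.R90.S3

end
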